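import Literature.Probability.Percolation.LongRangeOneDim
import Literature.Probability.Percolation.PercolationProofs
import HarnessLib

/-!
# Long-range bond percolation on `ℤ`: locality of exits and the bridge decomposition

Topic `Literature/Probability/Percolation`; companion of `LongRangeOneDim.lean` (deterministic
half of the Duminil-Copin–Garban–Tassion proof of the Aizenman–Newman dichotomy, *Long-range
models in 1D revisited*, AIHP 60 (2024), arXiv:2011.04642, §2.4).

## Contents (all proved)

* `ballEdges R x`, `exits_inter_ballEdges` — an exit of `x` from its `R`-ball uses only edges
  touching the ball (first-exit argument), whence `exits_iff_of_inter_ballEdges_eq`,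
  `measurableSet_exits`, `isUpperSet_exits`;
* `bridgeEdges L R x y` (finite), `determinedBy_isLongBridge`, `measurableSet_isLongBridge`,
  `isUpperSet_isLongBridge` — the bridge event of DGT §2.4 is a local increasing event;
* the bridge decomposition `isLongBridge_subset`:
  `{bridge {x,y}} ⊆ {xy open} ∩ ((exitAvoiding x y ∩ exitAvoiding y x) ∪ linked x y)`, with the
  determining sets `exitAvoidingEdges` (pairwise disjoint and avoiding `{x,y}`:
  `disjoint_exitAvoidingEdges`, `mk_not_mem_exitAvoidingEdges`) and `linkEdges`
  (`mk_not_mem_linkEdges`), `determinedBy_exitAvoiding`, `determinedBy_linked`,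
  `exitAvoiding_subset_exits` — the structure behind DGT's estimate
  `P[{x,y} is a bridge] ≤ (1 - e^{-β J_{x,y}}) (P[0 ↔ ℤ ∖ B_R]² + |B_R|² e^{-β(K-2R)})`
  (proof of Lemma 3, last display: "either there is an open edge in `ω ∖ {x,y}` between
  `[x-R,x+R)` and `[y-R,y+R)`, or the two events are independent").

The transfer lemmas for `touched`/`jumpBridged` and the final-step lemma (`A(K)`, `B(K)`) are in
`LongRangeEscape.lean`.

## References

* H. Duminil-Copin, C. Garban, V. Tassion, *Long-range models in 1D revisited*, Ann. Inst.
  H. Poincaré Probab. Statist. 60 (2024), arXiv:2011.04642: §2.4 (proof of Lemma 3).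
-/

namespace Literature.Probability.Percolation

open SimpleGraph

/-! ### Locality of exits -/

/-- The edges touching the `R`-ball `[x - R, x + R]` of `x`. [folklore] -/
def ballEdges (R : ℕ) (x : ℤ) : Set (Sym2 ℤ) :=
  {f | ∃ z ∈ f, x - R ≤ z ∧ z ≤ x + R}

/-- **Locality of the exit event**: if `x` exits its `R`-ball in `ω`, it already does so using
only open edges touching the ball (follow an exit path up to its first edge leaving the ball).
[cite: DuminilcopinGarbanTassion2024, §2.4 (proof of Lemma 3)] -/
theorem exits_inter_ballEdges {R : ℕ} {ω : BondConfig ℤ} {x : ℤ} (h : exits R ω x) :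
    exits R (ω ∩ ballEdges R x) x := by
  by_contra hno
  obtain ⟨z, hz, hr⟩ := h
  set H := openGraph (ω ∩ ballEdges R x) with hH
  set S : Set ℤ := {v | (x - R ≤ v ∧ v ≤ x + R) ∧ H.Reachable x v} with hS
  have hclosed : ∀ a b : ℤ, s(a, b) ∈ hr.some.edges → a ∈ S → b ∈ S := by
    intro a b hab ha
    obtain ⟨ha1, ha2⟩ : (x - R ≤ a ∧ a ≤ x + R) ∧ H.Reachable x a := ha
    have hadj := hr.some.adj_of_mem_edges hab
    rw [openGraph_adj] at hadj
    have hHab : H.Adj a b := by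
      rw [hH, openGraph_adj]
      exact ⟨⟨hadj.1, a, by simp, ha1⟩, hadj.2⟩
    by_cases hb : x - R ≤ b ∧ b ≤ x + R
    · exact ⟨hb, ha2.trans hHab.reachable⟩
    · exact absurd ⟨b, by omega, ha2.trans hHab.reachable⟩ hno
  have hzS : z ∈ S := hr.some.mem_of_edges_closed (S := S) ⟨by omega, Reachable.refl _⟩ hclosed
  obtain ⟨hz1, -⟩ : (x - R ≤ z ∧ z ≤ x + R) ∧ H.Reachable x z := hzS
  omega

/-- Configurations agreeing on the edges touching the `R`-ball of `x` have the same exit event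
at `x`. [folklore] -/
theorem exits_iff_of_inter_ballEdges_eq {R : ℕ} {ω ω' : BondConfig ℤ} {x : ℤ}
    (h : ω ∩ ballEdges R x = ω' ∩ ballEdges R x) : exits R ω x ↔ exits R ω' x := by
  constructor
  · intro hx
    have h1 := exits_inter_ballEdges hx
    rw [h] at h1
    exact exits_mono Set.inter_subset_left h1
  · intro hx
    have h1 := exits_inter_ballEdges hx
    rw [← h] at h1
    exact exits_mono Set.inter_subset_left h1

/-- The exit event `{ω | x exits its R-ball}` is measurable (a countable union of two-point
connection events). [folklore] -/
theorem measurableSet_exits (R : ℕ) (x : ℤ) : MeasurableSet {ω : BondConfig ℤ | exits R ω x} := by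
  have : {ω : BondConfig ℤ | exits R ω x} =
      ⋃ z ∈ {z : ℤ | (R : ℤ) < z - x ∨ (R : ℤ) < x - z}, openConn x z := by
    ext ω
    simp only [exits, Set.mem_setOf_eq, Set.mem_iUnion, openConn, exists_prop]
  rw [this]
  exact MeasurableSet.biUnion (Set.to_countable _) fun z _ => measurableSet_openConn_holds x z

/-- The exit event is increasing. [folklore] -/
theorem isUpperSet_exits (R : ℕ) (x : ℤ) : IsUpperSet {ω : BondConfig ℤ | exits R ω x} :=
  fun _ _ hle h => exits_mono hle h

/-! ### Bridges: determining set, measurability, monotonicity -/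

/-- The finite set of edges determining whether `{x, y}` is a bridge at truncation `L`: the edge
itself and the edges of length `≤ L` touching the `R`-balls of `x` and `y`. [folklore] -/
def bridgeEdges (L R : ℕ) (x y : ℤ) : Set (Sym2 ℤ) :=
  {s(x, y)} ∪ ((ballEdges R x ∪ ballEdges R y) ∩ {e | edgeLen e ≤ L})

/-- Edges of length `≤ L` touching a bounded interval `[a, b]` form a finite set. [folklore] -/
theorem finite_touching_of_edgeLen_le (L : ℕ) (a b : ℤ) :
    {f : Sym2 ℤ | (∃ z ∈ f, a ≤ z ∧ z ≤ b) ∧ edgeLen f ≤ L}.Finite := by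
  refine ((Set.finite_Icc (a - L) (b + L)).prod (Set.finite_Icc (a - L) (b + L))).image
    (fun p : ℤ × ℤ => s(p.1, p.2)) |>.subset ?_
  rintro f ⟨hz, hlen⟩
  induction f using Sym2.ind with
  | h u v =>
    rw [edgeLen_mk_le_iff] at hlen
    simp only [Sym2.mem_iff, exists_eq_or_imp, exists_eq_left] at hz
    refine ⟨(u, v), ⟨⟨?_, ?_⟩, ⟨?_, ?_⟩⟩, rfl⟩ <;> rcases hz with ⟨h1, h2⟩ | ⟨h1, h2⟩ <;> omega

/-- `bridgeEdges L R x y` is finite. [folklore] -/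
theorem bridgeEdges_finite (L R : ℕ) (x y : ℤ) : (bridgeEdges L R x y).Finite := by
  refine (Set.finite_singleton _).union ?_
  refine ((finite_touching_of_edgeLen_le L (x - R) (x + R)).union
    (finite_touching_of_edgeLen_le L (y - R) (y + R))).subset ?_
  rintro f ⟨hf | hf, hlen⟩
  · exact Or.inl ⟨hf, hlen⟩
  · exact Or.inr ⟨hf, hlen⟩

/-- **The bridge event is determined by `bridgeEdges`** (locality of the two exit events).
[cite: DuminilcopinGarbanTassion2024, §2.4 (proof of Lemma 3)] -/
theorem determinedBy_isLongBridge (L R : ℕ) (x y : ℤ) :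
    DeterminedBy {ω | IsLongBridge L R ω x y} (bridgeEdges L R x y) := by
  rw [determinedBy_iff]
  intro ω ω' h
  have he : s(x, y) ∈ ω ↔ s(x, y) ∈ ω' := by
    have := Set.ext_iff.1 h s(x, y)
    simp only [Set.mem_inter_iff, bridgeEdges, Set.mem_union, Set.mem_singleton_iff, true_or,
      and_true] at this
    exact this
  have hball : ∀ w : ℤ, (w = x ∨ w = y) →
      ((ω ∩ {e | edgeLen e ≤ L}) \ {s(x, y)}) ∩ ballEdges R w =
        ((ω' ∩ {e | edgeLen e ≤ L}) \ {s(x, y)}) ∩ ballEdges R w := by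
    intro w hw
    ext f
    simp only [Set.mem_inter_iff, Set.mem_sdiff, Set.mem_setOf_eq, Set.mem_singleton_iff]
    have key : f ∈ ballEdges R w → edgeLen f ≤ L → (f ∈ ω ↔ f ∈ ω') := by
      intro hf hlen
      have := Set.ext_iff.1 h f
      simp only [Set.mem_inter_iff] at this
      have hfB : f ∈ bridgeEdges L R x y := by
        refine Or.inr ⟨?_, hlen⟩
        rcases hw with rfl | rfl
        · exact Or.inl hf
        · exact Or.inr hf
      constructor
      · intro hfω; exact (this.1 ⟨hfω, hfB⟩).1
      · intro hfω; exact (this.2 ⟨hfω, hfB⟩).1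
    constructor
    · rintro ⟨⟨⟨h1, h2⟩, h3⟩, h4⟩; exact ⟨⟨⟨(key h4 h2).1 h1, h2⟩, h3⟩, h4⟩
    · rintro ⟨⟨⟨h1, h2⟩, h3⟩, h4⟩; exact ⟨⟨⟨(key h4 h2).2 h1, h2⟩, h3⟩, h4⟩
  simp only [Set.mem_setOf_eq, IsLongBridge]
  rw [he, exits_iff_of_inter_ballEdges_eq (hball x (Or.inl rfl)),
    exits_iff_of_inter_ballEdges_eq (hball y (Or.inr rfl))]

/-- The bridge event is measurable. [folklore] -/
theorem measurableSet_isLongBridge (L R : ℕ) (x y : ℤ) :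
    MeasurableSet {ω : BondConfig ℤ | IsLongBridge L R ω x y} := by
  have h := determinedBy_isLongBridge L R x y
  rw [← (bridgeEdges_finite L R x y).coe_toFinset] at h
  exact h.measurableSet_of_finset

/-- The bridge event is increasing. [folklore] -/
theorem isUpperSet_isLongBridge (L R : ℕ) (x y : ℤ) :
    IsUpperSet {ω : BondConfig ℤ | IsLongBridge L R ω x y} := by
  rintro ω ω' hle ⟨h1, h2, h3⟩
  have hmono : (ω ∩ {e | edgeLen e ≤ L}) \ {s(x, y)} ⊆ (ω' ∩ {e | edgeLen e ≤ L}) \ {s(x, y)} :=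
    Set.sdiff_subset_sdiff_left (Set.inter_subset_inter_left _ hle)
  exact ⟨hle h1, exits_mono hmono h2, exits_mono hmono h3⟩

/-! ### The bridge decomposition -/

/-- `x` exits its `R`-ball, inside the ball and then through an edge of length `≤ L` landing
outside BOTH the `R`-ball of `x` and the `R`-ball of `y` (the exit event for `x` that ignores
the edges towards `y`; DGT20, proof of Lemma 3, last display).
[cite: DuminilcopinGarbanTassion2024, §2.4 (proof of Lemma 3)] -/
def exitAvoiding (L R : ℕ) (x y : ℤ) : Set (BondConfig ℤ) :=
  {ω | ∃ w z : ℤ, (x - R ≤ w ∧ w ≤ x + R) ∧ ¬ (x - R ≤ z ∧ z ≤ x + R) ∧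
    ¬ (y - R ≤ z ∧ z ≤ y + R) ∧ s(w, z) ∈ ω ∧ edgeLen s(w, z) ≤ L ∧
    (openGraph (ω ∩ {f | ∀ v ∈ f, x - R ≤ v ∧ v ≤ x + R})).Reachable x w}

/-- The edges of length `≤ L` other than `{x, y}` meeting both the `R`-ball of `x` and the
`R`-ball of `y` (the determining set of `linked`). [folklore] -/
def linkEdges (L R : ℕ) (x y : ℤ) : Set (Sym2 ℤ) :=
  {f | f ≠ s(x, y) ∧ (∃ w ∈ f, x - R ≤ w ∧ w ≤ x + R) ∧ (∃ z ∈ f, y - R ≤ z ∧ z ≤ y + R) ∧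
    edgeLen f ≤ L}

/-- The `R`-balls of `x` and `y` are linked by an open edge of length `≤ L` other than `{x, y}`.
[cite: DuminilcopinGarbanTassion2024, §2.4 (proof of Lemma 3)] -/
def linked (L R : ℕ) (x y : ℤ) : Set (BondConfig ℤ) :=
  {ω | ∃ f ∈ linkEdges L R x y, f ∈ ω}

/-- `linkEdges` is symmetric in `x, y`. [folklore] -/
theorem linkEdges_comm (L R : ℕ) (x y : ℤ) : linkEdges L R x y = linkEdges L R y x := by
  ext f
  simp only [linkEdges, Set.mem_setOf_eq]
  rw [Sym2.eq_swap (a := x)]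
  tauto

/-- `linked` is symmetric in `x, y`. [folklore] -/
theorem linked_comm (L R : ℕ) (x y : ℤ) : linked L R x y = linked L R y x := by
  simp only [linked, linkEdges_comm L R x y]

/-- One half of the bridge decomposition: an exit of `x` in the truncated configuration minus
`{x, y}` is either an `exitAvoiding` exit or a link between the two balls.
[cite: DuminilcopinGarbanTassion2024, §2.4 (proof of Lemma 3)] -/
theorem exits_diff_imp {L R : ℕ} {ω : BondConfig ℤ} {x y : ℤ}
    (h : exits R ((ω ∩ {e | edgeLen e ≤ L}) \ {s(x, y)}) x) :
    ω ∈ exitAvoiding L R x y ∨ ω ∈ linked L R x y := by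
  by_contra hno
  rw [not_or] at hno
  obtain ⟨hA, hD⟩ := hno
  obtain ⟨z, hz, hr⟩ := h
  set H := openGraph (ω ∩ {f | ∀ v ∈ f, x - R ≤ v ∧ v ≤ x + R}) with hH
  set S : Set ℤ := {v | (x - R ≤ v ∧ v ≤ x + R) ∧ H.Reachable x v} with hS
  have hclosed : ∀ a b : ℤ, s(a, b) ∈ hr.some.edges → a ∈ S → b ∈ S := by
    intro a b hab ha
    obtain ⟨ha1, ha2⟩ : (x - R ≤ a ∧ a ≤ x + R) ∧ H.Reachable x a := ha
    have hadj := hr.some.adj_of_mem_edges hab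
    rw [openGraph_adj] at hadj
    obtain ⟨⟨⟨habω, hlen⟩, hne⟩, hab'⟩ := hadj
    have hlen' : edgeLen s(a, b) ≤ L := hlen
    have hne' : s(a, b) ≠ s(x, y) := hne
    by_cases hb : x - R ≤ b ∧ b ≤ x + R
    · have hHab : H.Adj a b := by
        rw [hH, openGraph_adj]
        refine ⟨⟨habω, ?_⟩, hab'⟩
        simp only [Set.mem_setOf_eq, Sym2.mem_iff, forall_eq_or_imp, forall_eq]
        exact ⟨ha1, hb⟩
      exact ⟨hb, ha2.trans hHab.reachable⟩
    · exfalso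
      by_cases hby : y - R ≤ b ∧ b ≤ y + R
      · exact hD ⟨s(a, b), ⟨hne', ⟨a, by simp, ha1⟩, ⟨b, by simp, hby⟩, hlen'⟩, habω⟩
      · exact hA ⟨a, b, ha1, hb, hby, habω, hlen', ha2⟩
  have hzS : z ∈ S := hr.some.mem_of_edges_closed (S := S) ⟨by omega, Reachable.refl _⟩ hclosed
  obtain ⟨hz1, -⟩ : (x - R ≤ z ∧ z ≤ x + R) ∧ H.Reachable x z := hzS
  omega

/-- **Bridge decomposition** (DGT20, proof of Lemma 3: "either there is an open edge in
`ω ∖ {x,y}` between `[x-R,x+R)` and `[y-R,y+R)`, or the two events are independent"): a bridge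
`{x, y}` forces the edge to be open and either a link between the two `R`-balls or the two
`exitAvoiding` events (which are determined by disjoint edge sets, see
`determinedBy_exitAvoiding`). [cite: DuminilcopinGarbanTassion2024, §2.4 (proof of Lemma 3)] -/
theorem isLongBridge_subset (L R : ℕ) (x y : ℤ) :
    {ω | IsLongBridge L R ω x y} ⊆ {ω | s(x, y) ∈ ω} ∩
      (exitAvoiding L R x y ∩ exitAvoiding L R y x ∪ linked L R x y) := by
  rintro ω ⟨he, hx, hy⟩
  refine ⟨he, ?_⟩
  rcases exits_diff_imp hx with h1 | h1
  · have hy' : exits R ((ω ∩ {e | edgeLen e ≤ L}) \ {s(y, x)}) y := by rwa [Sym2.eq_swap]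
    rcases exits_diff_imp hy' with h2 | h2
    · exact Or.inl ⟨h1, h2⟩
    · rw [linked_comm] at h2; exact Or.inr h2
  · exact Or.inr h1

/-- The determining set of `exitAvoiding L R x y`: edges of length `≤ L` with an endpoint in the
`R`-ball of `x` and no endpoint in the `R`-ball of `y`. [folklore] -/
def exitAvoidingEdges (L R : ℕ) (x y : ℤ) : Set (Sym2 ℤ) :=
  {f | (∃ w ∈ f, x - R ≤ w ∧ w ≤ x + R) ∧ (∀ z ∈ f, ¬ (y - R ≤ z ∧ z ≤ y + R)) ∧ edgeLen f ≤ L}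

/-- `exitAvoidingEdges` is finite. [folklore] -/
theorem exitAvoidingEdges_finite (L R : ℕ) (x y : ℤ) : (exitAvoidingEdges L R x y).Finite :=
  (finite_touching_of_edgeLen_le L (x - R) (x + R)).subset fun _ hf => ⟨hf.1, hf.2.2⟩

/-- `linkEdges` is finite. [folklore] -/
theorem linkEdges_finite (L R : ℕ) (x y : ℤ) : (linkEdges L R x y).Finite :=
  (finite_touching_of_edgeLen_le L (x - R) (x + R)).subset fun _ hf => ⟨hf.2.1, hf.2.2.2⟩

/-- `exitAvoiding L R x y` is determined by `exitAvoidingEdges L R x y`, provided the two balls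
are disjoint (`|x - y| > 2R`) and `2R ≤ L` (so that the edges inside the ball of `x` belong to the
determining set). [folklore] -/
theorem determinedBy_exitAvoiding {L R : ℕ} {x y : ℤ} (hL : 2 * R ≤ L)
    (hxy : (2 * R : ℤ) < y - x ∨ (2 * R : ℤ) < x - y) :
    DeterminedBy (exitAvoiding L R x y) (exitAvoidingEdges L R x y) := by
  rw [determinedBy_iff]
  -- one direction suffices by symmetry of the hypothesis
  suffices key : ∀ ω ω' : BondConfig ℤ, ω ∩ exitAvoidingEdges L R x y =
      ω' ∩ exitAvoidingEdges L R x y → ω ∈ exitAvoiding L R x y → ω' ∈ exitAvoiding L R x y from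
    fun ω ω' h => ⟨key ω ω' h, key ω' ω h.symm⟩
  intro ω ω' h ⟨w, z, hw, hzx, hzy, hωe, hlen, hr⟩
  have hinner : ω ∩ {f : Sym2 ℤ | ∀ v ∈ f, x - R ≤ v ∧ v ≤ x + R} =
      ω' ∩ {f : Sym2 ℤ | ∀ v ∈ f, x - R ≤ v ∧ v ≤ x + R} := by
    ext f
    induction f using Sym2.ind with
    | h u v =>
      simp only [Set.mem_inter_iff, Set.mem_setOf_eq, Sym2.mem_iff, forall_eq_or_imp, forall_eq]
      constructor
      · rintro ⟨hf, hu, hv⟩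
        have hfA : s(u, v) ∈ exitAvoidingEdges L R x y :=
          ⟨⟨u, by simp, hu⟩, by simp only [Sym2.mem_iff, forall_eq_or_imp, forall_eq]; omega,
            by rw [edgeLen_mk_le_iff]; omega⟩
        exact ⟨((Set.ext_iff.1 h _).1 ⟨hf, hfA⟩).1, hu, hv⟩
      · rintro ⟨hf, hu, hv⟩
        have hfA : s(u, v) ∈ exitAvoidingEdges L R x y :=
          ⟨⟨u, by simp, hu⟩, by simp only [Sym2.mem_iff, forall_eq_or_imp, forall_eq]; omega,
            by rw [edgeLen_mk_le_iff]; omega⟩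
        exact ⟨((Set.ext_iff.1 h _).2 ⟨hf, hfA⟩).1, hu, hv⟩
  have hwz : s(w, z) ∈ exitAvoidingEdges L R x y :=
    ⟨⟨w, by simp, hw⟩, by simp only [Sym2.mem_iff, forall_eq_or_imp, forall_eq]; omega, hlen⟩
  refine ⟨w, z, hw, hzx, hzy, ((Set.ext_iff.1 h _).1 ⟨hωe, hwz⟩).1, hlen, ?_⟩
  rwa [← hinner]

/-- `linked L R x y` is determined by `linkEdges L R x y`. [folklore] -/
theorem determinedBy_linked (L R : ℕ) (x y : ℤ) :
    DeterminedBy (linked L R x y) (linkEdges L R x y) := by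
  rw [determinedBy_iff]
  intro ω ω' h
  simp only [linked, Set.mem_setOf_eq]
  constructor
  · rintro ⟨f, hf, hfω⟩; exact ⟨f, hf, ((Set.ext_iff.1 h f).1 ⟨hfω, hf⟩).1⟩
  · rintro ⟨f, hf, hfω⟩; exact ⟨f, hf, ((Set.ext_iff.1 h f).2 ⟨hfω, hf⟩).1⟩

/-- `exitAvoiding` is contained in the plain exit event of `x`. [folklore] -/
theorem exitAvoiding_subset_exits (L R : ℕ) (x y : ℤ) :
    exitAvoiding L R x y ⊆ {ω | exits R ω x} := by
  rintro ω ⟨w, z, hw, hzx, -, hωe, -, hr⟩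
  refine ⟨z, by omega, ?_⟩
  have h1 : (openGraph ω).Reachable x w := hr.mono (openGraph_mono Set.inter_subset_left)
  by_cases hwz : w = z
  · subst hwz; exact h1
  · exact h1.trans (Adj.reachable ((openGraph_adj ω w z).2 ⟨hωe, hwz⟩))

/-- The two `exitAvoiding` determining sets are disjoint (an edge of the first has an endpoint in
the ball of `x`, an edge of the second has none). [folklore] -/
theorem disjoint_exitAvoidingEdges (L R : ℕ) (x y : ℤ) :
    Disjoint (exitAvoidingEdges L R x y) (exitAvoidingEdges L R y x) := by
  rw [Set.disjoint_left]
  rintro f ⟨⟨w, hwf, hw⟩, -, -⟩ ⟨-, hno, -⟩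
  exact hno w hwf hw

/-- The edge `{x, y}` is not in `exitAvoidingEdges L R x y` (its endpoint `y` lies in the ball
of `y`). [folklore] -/
theorem mk_not_mem_exitAvoidingEdges (L R : ℕ) (x y : ℤ) :
    s(x, y) ∉ exitAvoidingEdges L R x y := by
  rintro ⟨-, hno, -⟩
  exact hno y (by simp) ⟨by omega, by omega⟩

/-- The edge `{x, y}` is not in `exitAvoidingEdges L R y x`. [folklore] -/
theorem mk_not_mem_exitAvoidingEdges' (L R : ℕ) (x y : ℤ) :
    s(x, y) ∉ exitAvoidingEdges L R y x := by
  rintro ⟨-, hno, -⟩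
  exact hno x (by simp) ⟨by omega, by omega⟩

/-- The edge `{x, y}` is not in `linkEdges L R x y`. [folklore] -/
theorem mk_not_mem_linkEdges (L R : ℕ) (x y : ℤ) : s(x, y) ∉ linkEdges L R x y :=
  fun h => h.1 rfl

end Literature.Probability.Percolation
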